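import Summits.QuantumFields.YangMills.Theorems.EquipartitionCriticalityFreeEnergyLogCoefficientExpChartBasic
import HarnessLib

/-!
# The exponential chart of a compact matrix group: Haar measure in the chart, the soft Haar constant

Crux `FreeEnergyLogCoefficient` of route `EquipartitionCriticality` (`QuantumFields/YangMills`), line
`Sketch`, stub `stub_expChartPackage`, third file (template: `UnitaryCayleyChart`, §§Measure/Limit, for
the Cayley chart of `U(N)`). For a faithful continuous unitary `ρ : G →* M_N(ℂ)` of a compact group,
`ψ = expChart ρ : ℝ^D → G` (`D = dimE ρ`) and the chart measure `ν = chartMeasureE ρ (1/4)`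
(`ν(A) = σ(ψ(A ∩ b(0,1/4)))`, `σ` the Haar probability measure; `ψ` is injective on `b(0, 1/4)`):

* `chartMeasureE_apply`, `haar_setOf_norm_sub_le` (Hilbert–Schmidt balls are left translates),
  the BALL SQUEEZE `σ(B(1, δ/κE(r))) ≤ ν(b(a,δ)) ≤ σ(B(1,δ))` for `‖a‖ ≤ r ≤ r₁`, `δ ≤ r`
  (`chartMeasureE_closedBall_le`, `haar_gball_le_chartMeasureE_closedBall`; the radius
  `r₁ = chartRadius` comes from von Neumann's local surjectivity);
* `exists_tendsto_ballRatioE`, `haarConstE_spec` : the ratio `σ(B(1,δ))/vol(b(0,δ))` tends to the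
  soft Haar constant `haarConstE ρ ∈ (0, ∞)` as `δ → 0⁺` (Lebesgue differentiation at a density
  point of `ν`, Vitali covering for positivity) — Chatterjee Thm. 6.1/11.1 with a soft constant.

Reference: S. Chatterjee, arXiv:1602.01222, §6 (Thm. 6.1), §11 (Thm. 11.1, Cor. 11.3, Lemma 11.5).
-/

noncomputable section

open scoped Matrix Matrix.Norms.Frobenius Topology ENNReal NNReal
open NormedSpace Filter Set MeasureTheory Measure Metric
open Literature.MathematicalPhysics.QuantumLattice Literature.MathematicalPhysics.QuantumFieldTheory

namespace Summit.QuantumFields.YangMills.Theorems.FreeEnergyLogCoefficient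

-- NEEDS ExpChart
-- BODY START
section ChartMeasure

variable {N : ℕ} {G : Type*} [Group G] [TopologicalSpace G] [IsTopologicalGroup G] [CompactSpace G]
  [MeasurableSpace G] [BorelSpace G] (ρ : G →* (Matrix (Fin N) (Fin N) ℂ))

/-! ### Hilbert–Schmidt balls in `G` -/

omit [IsTopologicalGroup G] [CompactSpace G] [MeasurableSpace G] [BorelSpace G] in
/-- `g ↦ ‖ρ g − V‖` is continuous. [folklore] -/
theorem continuous_norm_rho_sub (hρ : Continuous ρ) (V : (Matrix (Fin N) (Fin N) ℂ)) : Continuous fun g : G => ‖ρ g - V‖ :=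
  (hρ.sub continuous_const).norm

omit [IsTopologicalGroup G] [CompactSpace G] [MeasurableSpace G] [BorelSpace G] in
/-- The Hilbert–Schmidt ball `{g | ‖ρ g − 1‖ ≤ δ}` is closed. [folklore] -/
theorem isClosed_gball (hρ : Continuous ρ) (δ : ℝ) : IsClosed {g : G | ‖ρ g - 1‖ ≤ δ} :=
  isClosed_le (continuous_norm_rho_sub ρ hρ 1) continuous_const

omit [IsTopologicalGroup G] [CompactSpace G] in
/-- The Hilbert–Schmidt ball is measurable. [folklore] -/
theorem measurableSet_gball (hρ : Continuous ρ) (δ : ℝ) : MeasurableSet {g : G | ‖ρ g - 1‖ ≤ δ} :=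
  (isClosed_gball ρ hρ δ).measurableSet

omit [TopologicalSpace G] [IsTopologicalGroup G] [CompactSpace G] [MeasurableSpace G] [BorelSpace G] in
/-- Monotonicity of the balls in the radius. [folklore] -/
theorem gball_mono {δ δ' : ℝ} (h : δ ≤ δ') : {g : G | ‖ρ g - 1‖ ≤ δ} ⊆ {g : G | ‖ρ g - 1‖ ≤ δ'} :=
  fun _ hg => le_trans hg h

/-- Haar measure charges every ball `B(1, δ)`, `δ > 0`. [folklore] -/
theorem haar_gball_pos (hρ : Continuous ρ) {δ : ℝ} (hδ : 0 < δ) :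
    0 < haarProbability G {g : G | ‖ρ g - 1‖ ≤ δ} := by
  have ho : IsOpen {g : G | ‖ρ g - 1‖ < δ} := isOpen_lt (continuous_norm_rho_sub ρ hρ 1) continuous_const
  refine lt_of_lt_of_le (ho.measure_pos (haarProbability G) ⟨1, by simpa using hδ⟩) ?_
  exact measure_mono fun g (hg : ‖ρ g - 1‖ < δ) => hg.le

omit [TopologicalSpace G] [IsTopologicalGroup G] [CompactSpace G] [MeasurableSpace G] [BorelSpace G] in
/-- Hilbert–Schmidt distances seen through a unitary `ρ` are left invariant:
`‖ρ g − ρ h‖ = ‖ρ(h⁻¹ g) − 1‖` (Chatterjee Lemma 11.5). [cite: arXiv160201222, Lemma 11.5] -/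
theorem norm_rho_sub_rho (hU : ∀ g, ρ g ∈ Matrix.unitaryGroup (Fin N) ℂ) (g h : G) :
    ‖ρ g - ρ h‖ = ‖ρ (h⁻¹ * g) - 1‖ := by
  have hV : ρ h⁻¹ * ρ h = 1 := by rw [← map_mul, inv_mul_cancel, map_one]
  have e : ρ (h⁻¹ * g) - 1 = ρ h⁻¹ * (ρ g - ρ h) := by rw [Matrix.mul_sub, hV, map_mul]
  rw [e, Matrix.frobenius_norm_unitaryGroup_mul ⟨ρ h⁻¹, hU h⁻¹⟩]

omit [TopologicalSpace G] [IsTopologicalGroup G] [CompactSpace G] [MeasurableSpace G] [BorelSpace G] in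
/-- The ball around `h` is the left translate of the ball around `1`. [folklore] -/
theorem setOf_norm_sub_le_eq_preimage (hU : ∀ g, ρ g ∈ Matrix.unitaryGroup (Fin N) ℂ) (h : G) (δ : ℝ) :
    {g : G | ‖ρ g - ρ h‖ ≤ δ} = (fun g => h⁻¹ * g) ⁻¹' {g : G | ‖ρ g - 1‖ ≤ δ} := by
  ext g
  simp only [mem_setOf_eq, mem_preimage, norm_rho_sub_rho ρ hU g h]

/-- Haar measure of the ball around `h` equals that of the ball around `1`
(Chatterjee Lemma 11.5). [cite: arXiv160201222, Lemma 11.5] -/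
theorem haar_setOf_norm_sub_le (hU : ∀ g, ρ g ∈ Matrix.unitaryGroup (Fin N) ℂ) (h : G) (δ : ℝ) :
    haarProbability G {g : G | ‖ρ g - ρ h‖ ≤ δ} = haarProbability G {g : G | ‖ρ g - 1‖ ≤ δ} := by
  rw [setOf_norm_sub_le_eq_preimage ρ hU, measure_preimage_mul]

/-! ### The chart measure -/

omit [IsTopologicalGroup G] [MeasurableSpace G] [BorelSpace G] in
/-- The chart is injective on the ball `b(0, 1/4)` (inverse Lipschitz bound with `e^{1/4} < 2`). [cite: arXiv160201222, Lemma 11.2] -/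
theorem injOn_expChart (hρ : Continuous ρ) : Set.InjOn (expChart ρ) (Metric.closedBall (0 : (EuclideanSpace ℝ (Fin (dimE ρ)))) (1 / 4)) := by
  intro a ha b hb hab
  rw [mem_closedBall, dist_zero_right] at ha hb
  have h := le_norm_rho_expChart_sub ρ hρ ha hb
  rw [hab, sub_self, norm_zero] at h
  have hpos : 0 < 2 - Real.exp (1 / 4) := by
    have := exp_four_mul_le (r := 1 / 16) le_rfl
    norm_num at this ⊢; linarith
  have h0 : ‖a - b‖ ≤ 0 := by nlinarith [norm_nonneg (a - b)]
  exact sub_eq_zero.1 (norm_le_zero_iff.1 h0)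

omit [IsTopologicalGroup G] in
/-- The chart restricted to the ball `b(0, 1/4)` is a measurable embedding (continuous injective map
from a Polish space; Lusin–Souslin). [folklore] -/
theorem measurableEmbedding_restrict_expChart (hρ : Continuous ρ) (hinj : Function.Injective ρ) :
    MeasurableEmbedding (Set.restrict (Metric.closedBall (0 : (EuclideanSpace ℝ (Fin (dimE ρ)))) (1 / 4)) (expChart ρ)) := by
  haveI : T2Space G := T2Space.of_injective_continuous hinj hρ
  haveI : PolishSpace ↥(Metric.closedBall (0 : (EuclideanSpace ℝ (Fin (dimE ρ)))) (1 / 4)) := isClosed_closedBall.polishSpace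
  exact ((continuous_expChart ρ hρ hinj).comp continuous_subtype_val).measurableEmbedding
    ((injOn_iff_injective).1 (injOn_expChart ρ hρ))

/-- **The chart measure on sets**: `ν(A) = σ(ψ(A ∩ b(0,1/4)))` for every set `A`. [cite: arXiv160201222, §11] -/
theorem chartMeasureE_apply (hρ : Continuous ρ) (hinj : Function.Injective ρ) (A : Set (EuclideanSpace ℝ (Fin (dimE ρ)))) :
    chartMeasureE ρ (1 / 4) A = haarProbability G (expChart ρ '' (A ∩ (Metric.closedBall (0 : (EuclideanSpace ℝ (Fin (dimE ρ)))) (1 / 4)))) := by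
  rw [chartMeasureE, (MeasurableEmbedding.subtype_coe isClosed_closedBall.measurableSet).map_apply,
    (measurableEmbedding_restrict_expChart ρ hρ hinj).comap_apply, Set.restrict_eq, Set.image_comp,
    Subtype.image_preimage_coe, Set.inter_comm]

/-- `ν` is a finite measure. [folklore] -/
theorem isFiniteMeasure_chartMeasureE (hρ : Continuous ρ) (hinj : Function.Injective ρ) :
    IsFiniteMeasure (chartMeasureE ρ (1 / 4)) :=
  ⟨by rw [chartMeasureE_apply ρ hρ hinj]; exact measure_lt_top _ _⟩

omit [IsTopologicalGroup G] [MeasurableSpace G] [BorelSpace G] in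
/-- The chart image of a ball is contained in the Hilbert–Schmidt ball of the same radius around the
image of the centre (the chart is `1`-Lipschitz; Chatterjee Cor. 11.3, second inclusion). [cite: arXiv160201222, Cor. 11.3] -/
theorem image_expChart_closedBall_subset (hρ : Continuous ρ) (a : (EuclideanSpace ℝ (Fin (dimE ρ)))) (δ : ℝ) :
    expChart ρ '' closedBall a δ ⊆ {g : G | ‖ρ g - ρ (expChart ρ a)‖ ≤ δ} := by
  rintro _ ⟨b, hb, rfl⟩
  rw [mem_closedBall, dist_eq_norm] at hb
  exact (norm_rho_expChart_sub_le ρ hρ b a).trans hb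

/-- **Ball squeeze, upper half**: `ν(b(a, δ)) ≤ σ(B(1, δ))` for every centre and radius. [cite: arXiv160201222, §11 (proof of Thm. 11.1)] -/
theorem chartMeasureE_closedBall_le (hρ : Continuous ρ) (hinj : Function.Injective ρ)
    (hU : ∀ g, ρ g ∈ Matrix.unitaryGroup (Fin N) ℂ) (a : (EuclideanSpace ℝ (Fin (dimE ρ)))) (δ : ℝ) :
    chartMeasureE ρ (1 / 4) (closedBall a δ) ≤ haarProbability G {g : G | ‖ρ g - 1‖ ≤ δ} := by
  rw [chartMeasureE_apply ρ hρ hinj, ← haar_setOf_norm_sub_le ρ hU (expChart ρ a)]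
  exact measure_mono ((image_mono inter_subset_left).trans (image_expChart_closedBall_subset ρ hρ a δ))

/-! ### The admissible radius and the lower ball squeeze -/

omit [IsTopologicalGroup G] [MeasurableSpace G] [BorelSpace G] in
/-- **An admissible chart radius** `r₁ ∈ (0, 1/16]`: `B(1, 2r) ` lies in the von Neumann
neighbourhood for `r ≤ r₁` (existence; the value is immaterial). [cite: vonNeumann1929, §3] -/
theorem exists_chartRadius (hρ : Continuous ρ) (hinj : Function.Injective ρ)
    (hU : ∀ g, ρ g ∈ Matrix.unitaryGroup (Fin N) ℂ) :
    ∃ r₁ : ℝ, 0 < r₁ ∧ r₁ ≤ 1 / 16 ∧ ∀ g : G, ‖ρ g - 1‖ ≤ 2 * r₁ →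
      ∃ a : (EuclideanSpace ℝ (Fin (dimE ρ))), expChart ρ a = g ∧ ‖a‖ ≤ 2 * ‖ρ g - 1‖ := by
  obtain ⟨r₀, hr₀, h⟩ := exists_chart_radius ρ hρ hinj hU
  refine ⟨min (r₀ / 4) (1 / 16), lt_min (by positivity) (by norm_num), min_le_right _ _, fun g hg => h g ?_⟩
  have : min (r₀ / 4) (1 / 16) ≤ r₀ / 4 := min_le_left _ _
  linarith

omit [IsTopologicalGroup G] [MeasurableSpace G] [BorelSpace G] in
/-- **Local surjectivity in squeezed form** (Chatterjee Cor. 11.3, first inclusion, for the exponential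
chart): if every `g` with `‖ρ g − 1‖ ≤ 2r₁` is in the chart image with `‖a‖ ≤ 2‖ρ g − 1‖`, then for
`‖a‖ ≤ r ≤ r₁ ≤ 1/16` and `0 ≤ δ ≤ r`, `{g | ‖ρ g − ρ ψ(a)‖ ≤ δ/κE(r)} ⊆ ψ(b(a, δ))`. [cite: arXiv160201222, Cor. 11.3] -/
theorem setOf_norm_sub_le_subset_image_expChart (hρ : Continuous ρ) {r₁ : ℝ} (hr₁ : r₁ ≤ 1 / 16)
    (hsurj : ∀ g : G, ‖ρ g - 1‖ ≤ 2 * r₁ → ∃ a : (EuclideanSpace ℝ (Fin (dimE ρ))), expChart ρ a = g ∧ ‖a‖ ≤ 2 * ‖ρ g - 1‖)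
    (hinj : Function.Injective ρ) {r δ : ℝ} (hr : r ≤ r₁) {a : (EuclideanSpace ℝ (Fin (dimE ρ)))} (ha : ‖a‖ ≤ r) (hδ : 0 ≤ δ)
    (hδr : δ ≤ r) :
    {g : G | ‖ρ g - ρ (expChart ρ a)‖ ≤ δ / κE r} ⊆ expChart ρ '' closedBall a δ := by
  intro g hg
  rw [mem_setOf_eq] at hg
  have hr0 : 0 ≤ r := hδ.trans hδr
  have hr16 : r ≤ 1 / 16 := hr.trans hr₁
  have hκ1 := one_le_κE hr0
  have hκpos := κE_pos hr0
  have hδκ : δ / κE r ≤ δ := div_le_self hδ hκ1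
  -- `g` is close to `1`, hence in the chart image
  have hg1 : ‖ρ g - 1‖ ≤ 2 * r := by
    calc ‖ρ g - 1‖ = ‖(ρ g - ρ (expChart ρ a)) + (ρ (expChart ρ a) - 1)‖ := by rw [sub_add_sub_cancel]
      _ ≤ ‖ρ g - ρ (expChart ρ a)‖ + ‖ρ (expChart ρ a) - 1‖ := norm_add_le _ _
      _ ≤ δ + ‖a‖ := add_le_add (hg.trans hδκ) (norm_rho_expChart_sub_one_le ρ hρ hinj a)
      _ ≤ 2 * r := by linarith
  obtain ⟨b, hbg, hbn⟩ := hsurj g (hg1.trans (by linarith))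
  have hb4 : ‖b‖ ≤ 4 * r := hbn.trans (by linarith)
  have ha4 : ‖a‖ ≤ 4 * r := ha.trans (by linarith)
  refine ⟨b, ?_, hbg⟩
  rw [mem_closedBall, dist_eq_norm]
  -- inverse Lipschitz at radius `4r`: `(2 - e^{4r}) ‖b - a‖ ≤ ‖ρ g - ρ ψ a‖ ≤ δ (2 - e^{4r})`
  have hinvL := le_norm_rho_expChart_sub ρ hρ hb4 ha4
  rw [hbg] at hinvL
  have hκeq : κE r = (2 - Real.exp (4 * r))⁻¹ := κE_eq hr16
  have hpos : 0 < 2 - Real.exp (4 * r) := by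
    have := exp_four_mul_le hr16; linarith
  have hg' : ‖ρ g - ρ (expChart ρ a)‖ ≤ δ * (2 - Real.exp (4 * r)) := by
    rw [hκeq, div_inv_eq_mul] at hg; exact hg
  by_contra hcon
  push Not at hcon
  have : δ * (2 - Real.exp (4 * r)) < (2 - Real.exp (4 * r)) * ‖b - a‖ := by nlinarith
  linarith

/-- **Ball squeeze, lower half**: `σ(B(1, δ/κE(r))) ≤ ν(b(a, δ))` for `‖a‖ ≤ r ≤ r₁`, `0 ≤ δ ≤ r`
(the ball `b(a, δ)` lies inside `b(0, 1/4)`). [cite: arXiv160201222, §11 (proof of Thm. 11.1)] -/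
theorem haar_gball_le_chartMeasureE_closedBall (hρ : Continuous ρ) (hinj : Function.Injective ρ)
    (hU : ∀ g, ρ g ∈ Matrix.unitaryGroup (Fin N) ℂ) {r₁ : ℝ} (hr₁ : r₁ ≤ 1 / 16)
    (hsurj : ∀ g : G, ‖ρ g - 1‖ ≤ 2 * r₁ → ∃ a : (EuclideanSpace ℝ (Fin (dimE ρ))), expChart ρ a = g ∧ ‖a‖ ≤ 2 * ‖ρ g - 1‖)
    {r δ : ℝ} (hr : r ≤ r₁) {a : (EuclideanSpace ℝ (Fin (dimE ρ)))} (ha : ‖a‖ ≤ r) (hδ : 0 ≤ δ) (hδr : δ ≤ r) :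
    haarProbability G {g : G | ‖ρ g - 1‖ ≤ δ / κE r} ≤ chartMeasureE ρ (1 / 4) (closedBall a δ) := by
  have hsub : closedBall a δ ⊆ (Metric.closedBall (0 : (EuclideanSpace ℝ (Fin (dimE ρ)))) (1 / 4)) := by
    intro x hx
    rw [mem_closedBall, dist_zero_right]
    rw [mem_closedBall, dist_eq_norm] at hx
    have : ‖x‖ ≤ ‖x - a‖ + ‖a‖ := norm_le_norm_sub_add x a
    linarith [hr.trans hr₁]
  rw [chartMeasureE_apply ρ hρ hinj, inter_eq_self_of_subset_left hsub,
    ← haar_setOf_norm_sub_le ρ hU (expChart ρ a)]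
  exact measure_mono (setOf_norm_sub_le_subset_image_expChart ρ hρ hr₁ hsurj hinj hr ha hδ hδr)

/-! ### The small-ball ratio and its limit -/

/-- `ν(b(a,δ))/vol(b(a,δ)) ≤ g(δ) = σ(B(1,δ))/vol(b(0,δ))` for every centre. [cite: arXiv160201222, §11 (proof of Thm. 11.1)] -/
theorem ratio_le_ballRatioE (hρ : Continuous ρ) (hinj : Function.Injective ρ)
    (hU : ∀ g, ρ g ∈ Matrix.unitaryGroup (Fin N) ℂ) (a : (EuclideanSpace ℝ (Fin (dimE ρ)))) (δ : ℝ) :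
    chartMeasureE ρ (1 / 4) (closedBall a δ) / volume (closedBall a δ) ≤ ballRatioE ρ δ := by
  rw [ballRatioE, ← Measure.addHaar_closedBall_center volume a δ]
  exact ENNReal.div_le_div_right (chartMeasureE_closedBall_le ρ hρ hinj hU a δ) _

/-- `g(t) ≤ κE(r)^D ν(b(a, κE(r) t))/vol(b(a, κE(r) t))` for `‖a‖ ≤ r ≤ r₁`, `κE(r) t ≤ r`. [cite: arXiv160201222, §11 (proof of Thm. 11.1)] -/
theorem ballRatioE_le (hρ : Continuous ρ) (hinj : Function.Injective ρ)
    (hU : ∀ g, ρ g ∈ Matrix.unitaryGroup (Fin N) ℂ) {r₁ : ℝ} (hr₁ : r₁ ≤ 1 / 16)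
    (hsurj : ∀ g : G, ‖ρ g - 1‖ ≤ 2 * r₁ → ∃ a : (EuclideanSpace ℝ (Fin (dimE ρ))), expChart ρ a = g ∧ ‖a‖ ≤ 2 * ‖ρ g - 1‖)
    {r t : ℝ} (hr : r ≤ r₁) {a : (EuclideanSpace ℝ (Fin (dimE ρ)))} (ha : ‖a‖ ≤ r) (ht : 0 < t) (htr : κE r * t ≤ r) :
    ballRatioE ρ t ≤ ENNReal.ofReal (κE r ^ dimE ρ) *
      (chartMeasureE ρ (1 / 4) (closedBall a (κE r * t)) / volume (closedBall a (κE r * t))) := by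
  have hr0 : 0 ≤ r := (norm_nonneg a).trans ha
  have hκ := κE_pos hr0
  have h := haar_gball_le_chartMeasureE_closedBall ρ hρ hinj hU hr₁ hsurj hr ha
    (by positivity : 0 ≤ κE r * t) htr
  rw [mul_div_cancel_left₀ t hκ.ne'] at h
  have hK0 : ENNReal.ofReal (κE r ^ dimE ρ) ≠ 0 := by
    rw [ENNReal.ofReal_ne_zero_iff]; positivity
  rw [ballRatioE, ← Measure.addHaar_closedBall_center volume a t,
    ← ENNReal.mul_div_mul_left (haarProbability G {g : G | ‖ρ g - 1‖ ≤ t}) (volume (closedBall a t))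
      hK0 ENNReal.ofReal_ne_top, ← volume_closedBall_fin_mul a hκ ht.le, mul_div_assoc]
  gcongr

/-- There is a density point of `ν` with finite density inside every ball `b(0, r)`, `r > 0`. [folklore] -/
theorem exists_good_point (hρ : Continuous ρ) (hinj : Function.Injective ρ) {r : ℝ} (hr : 0 < r) :
    ∃ a : (EuclideanSpace ℝ (Fin (dimE ρ))), ‖a‖ ≤ r ∧ ∃ R : ℝ≥0∞, R < ∞ ∧
      Tendsto (fun δ => chartMeasureE ρ (1 / 4) (closedBall a δ) / volume (closedBall a δ))
        (𝓝[>] 0) (𝓝 R) := by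
  haveI := isFiniteMeasure_chartMeasureE ρ hρ hinj
  have h1 := Besicovitch.ae_tendsto_rnDeriv (chartMeasureE ρ (1 / 4)) (volume : Measure (EuclideanSpace ℝ (Fin (dimE ρ))))
  have h2 := Measure.rnDeriv_lt_top (chartMeasureE ρ (1 / 4)) (volume : Measure (EuclideanSpace ℝ (Fin (dimE ρ))))
  have h := h1.and h2
  by_contra hcon
  push Not at hcon
  have hsub : closedBall (0 : (EuclideanSpace ℝ (Fin (dimE ρ)))) r ⊆ {a | ¬ (Tendsto (fun δ => chartMeasureE ρ (1 / 4) (closedBall a δ) /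
      volume (closedBall a δ)) (𝓝[>] 0) (𝓝 ((chartMeasureE ρ (1 / 4)).rnDeriv volume a)) ∧
      (chartMeasureE ρ (1 / 4)).rnDeriv volume a < ∞)} := by
    intro a ha
    rw [mem_closedBall, dist_zero_right] at ha
    rintro ⟨hT, hF⟩
    exact hcon a ha _ hF hT
  have h0 : volume (closedBall (0 : (EuclideanSpace ℝ (Fin (dimE ρ)))) r) = 0 := measure_mono_null hsub (ae_iff.1 h)
  exact absurd h0 (volume_closedBall_fin_pos 0 hr).ne'

/-- **Existence of the soft Haar constant** (Chatterjee Thm. 6.1 / Thm. 11.1 for a compact matrix group,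
soft form): `σ(B(1,δ))/vol(b(0,δ))` has a limit `c ∈ (0, ∞)` as `δ → 0⁺`. Lebesgue differentiation at a
density point of `ν` in `b(0, r)` and the ball squeeze give `limsup ≤ κE(r)^D liminf` for every small
`r`; positivity by the Vitali covering lemma. [cite: arXiv160201222, Thm. 11.1 (analogue)] -/
theorem exists_tendsto_ballRatioE (hρ : Continuous ρ) (hinj : Function.Injective ρ)
    (hU : ∀ g, ρ g ∈ Matrix.unitaryGroup (Fin N) ℂ) :
    ∃ c : ℝ≥0∞, c ≠ 0 ∧ c ≠ ∞ ∧ Tendsto (ballRatioE ρ) (𝓝[>] 0) (𝓝 c) := by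
  haveI := isFiniteMeasure_chartMeasureE ρ hρ hinj
  obtain ⟨r₁, hr₁0, hr₁, hsurj⟩ := exists_chartRadius ρ hρ hinj hU
  set g := ballRatioE ρ with hg
  set M := limsup g (𝓝[>] 0) with hM
  set L := liminf g (𝓝[>] 0) with hL
  -- Step 1: from a good point at scale `r ≤ r₁`: `R ≤ L` and `M ≤ κE(r)^D R`.
  have key : ∀ r : ℝ, 0 < r → r ≤ r₁ →
      ∃ R : ℝ≥0∞, R < ∞ ∧ R ≤ L ∧ M ≤ ENNReal.ofReal (κE r ^ dimE ρ) * R := by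
    intro r hr hrr
    obtain ⟨a, ha, R, hRfin, hR⟩ := exists_good_point ρ hρ hinj hr
    have hκ := κE_pos hr.le
    refine ⟨R, hRfin, ?_, ?_⟩
    · rw [← hR.liminf_eq]
      exact liminf_le_liminf (Eventually.of_forall fun δ => ratio_le_ballRatioE ρ hρ hinj hU a δ)
    · have hT : Tendsto (fun t => ENNReal.ofReal (κE r ^ dimE ρ) *
          (chartMeasureE ρ (1 / 4) (closedBall a (κE r * t)) / volume (closedBall a (κE r * t))))
          (𝓝[>] 0) (𝓝 (ENNReal.ofReal (κE r ^ dimE ρ) * R)) :=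
        ENNReal.Tendsto.const_mul (hR.comp (UnitaryCayley.tendsto_const_mul_nhdsGT hκ)) (Or.inr ENNReal.ofReal_ne_top)
      rw [← hT.limsup_eq]
      refine limsup_le_limsup ?_
      filter_upwards [Ioc_mem_nhdsGT (show (0 : ℝ) < r / κE r from div_pos hr hκ)] with t ht
      exact ballRatioE_le ρ hρ hinj hU hr₁ hsurj hrr ha ht.1 (by rw [← le_div_iff₀' hκ]; exact ht.2)
  -- Step 2: `M < ∞` and `M ≤ L`.
  obtain ⟨R₀, hR₀fin, -, hMR₀⟩ := key r₁ hr₁0 le_rfl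
  have hMfin : M < ∞ := lt_of_le_of_lt hMR₀ (ENNReal.mul_lt_top ENNReal.ofReal_lt_top hR₀fin)
  have hLM : L ≤ M := liminf_le_limsup
  have hLfin : L < ∞ := lt_of_le_of_lt hLM hMfin
  have hML : M ≤ L := by
    have hreal : ∀ r : ℝ, 0 < r → r ≤ r₁ → M.toReal ≤ κE r ^ dimE ρ * L.toReal := by
      intro r hr hrr
      obtain ⟨R, -, hRL, hMR⟩ := key r hr hrr
      have h1 : M ≤ ENNReal.ofReal (κE r ^ dimE ρ) * L := hMR.trans (by gcongr)
      have h2 := ENNReal.toReal_mono (ENNReal.mul_ne_top ENNReal.ofReal_ne_top hLfin.ne) h1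
      rwa [ENNReal.toReal_mul, ENNReal.toReal_ofReal (pow_nonneg (κE_pos hr.le).le _)] at h2
    have hlim : Tendsto (fun r : ℝ => κE r ^ dimE ρ * L.toReal) (𝓝[>] 0) (𝓝 (κE 0 ^ dimE ρ * L.toReal)) :=
      ((continuous_κE.pow _).mul continuous_const).continuousAt.tendsto.mono_left nhdsWithin_le_nhds
    rw [κE_zero, one_pow, one_mul] at hlim
    have hle : M.toReal ≤ L.toReal :=
      ge_of_tendsto hlim (by
        filter_upwards [Ioc_mem_nhdsGT hr₁0] with r hr
        exact hreal r hr.1 hr.2)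
    exact (ENNReal.toReal_le_toReal hMfin.ne hLfin.ne).1 hle
  -- Step 3: the limit exists and equals `M`.
  have hT : Tendsto g (𝓝[>] 0) (𝓝 M) := tendsto_of_le_liminf_of_limsup_le hML le_rfl
  refine ⟨M, ?_, hMfin.ne, hT⟩
  -- Step 4: `M ≠ 0` by a Vitali covering argument on the ball `b(0, r₁)`.
  intro hM0
  rw [hM0] at hT
  set S : Set (EuclideanSpace ℝ (Fin (dimE ρ))) := closedBall 0 r₁ with hS
  have hSpos : 0 < chartMeasureE ρ (1 / 4) S := by
    have h := haar_gball_le_chartMeasureE_closedBall ρ hρ hinj hU hr₁ hsurj (r := r₁) (δ := r₁) le_rfl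
      (a := 0) (by simpa using hr₁0.le) hr₁0.le le_rfl
    exact lt_of_lt_of_le (haar_gball_pos ρ hρ (div_pos hr₁0 (κE_pos hr₁0.le))) h
  have hSfin : volume S ≠ ∞ := (volume_closedBall_fin_lt_top _ _).ne
  obtain ⟨ε, hε, hεS⟩ := ENNReal.exists_nnreal_pos_mul_lt hSfin hSpos.ne'
  have hfreq : ∀ x ∈ S, ∃ᶠ t in (Besicovitch.vitaliFamily (chartMeasureE ρ (1 / 4))).filterAt x,
      chartMeasureE ρ (1 / 4) t ≤ (ε • (volume : Measure (EuclideanSpace ℝ (Fin (dimE ρ))))) t := by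
    intro x _
    have hev : ∀ᶠ δ in 𝓝[>] (0 : ℝ), chartMeasureE ρ (1 / 4) (closedBall x δ) ≤
        (ε • (volume : Measure (EuclideanSpace ℝ (Fin (dimE ρ))))) (closedBall x δ) := by
      filter_upwards [hT.eventually_lt_const (show (0 : ℝ≥0∞) < ε by exact_mod_cast hε),
        self_mem_nhdsWithin] with δ hδ hδ0
      have h := (ratio_le_ballRatioE ρ hρ hinj hU x δ).trans_lt hδ
      rw [ENNReal.div_lt_iff (Or.inl (volume_closedBall_fin_pos x hδ0).ne')
        (Or.inl (volume_closedBall_fin_lt_top x δ).ne)] at h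
      rw [Measure.coe_nnreal_smul_apply]
      exact h.le
    exact (Besicovitch.tendsto_filterAt (chartMeasureE ρ (1 / 4)) x).frequently hev.frequently
  have hle := (Besicovitch.vitaliFamily (chartMeasureE ρ (1 / 4))).measure_le_of_frequently_le
    (ε • (volume : Measure (EuclideanSpace ℝ (Fin (dimE ρ))))) Measure.AbsolutelyContinuous.rfl S hfreq
  rw [Measure.coe_nnreal_smul_apply] at hle
  exact absurd hle (not_le.2 hεS)

/-- **The soft Haar constant**: `haarConstE ρ ∈ (0, ∞)` and `σ(B(1,δ))/vol(b(0,δ)) → haarConstE ρ` as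
`δ → 0⁺`. [cite: arXiv160201222, Thm. 11.1 (analogue)] -/
theorem haarConstE_spec (hρ : Continuous ρ) (hinj : Function.Injective ρ)
    (hU : ∀ g, ρ g ∈ Matrix.unitaryGroup (Fin N) ℂ) :
    haarConstE ρ ≠ 0 ∧ haarConstE ρ ≠ ∞ ∧ Tendsto (ballRatioE ρ) (𝓝[>] 0) (𝓝 (haarConstE ρ)) := by
  obtain ⟨c, hc0, hctop, hT⟩ := exists_tendsto_ballRatioE ρ hρ hinj hU
  have heq : haarConstE ρ = c := hT.limUnder_eq
  rw [heq]
  exact ⟨hc0, hctop, hT⟩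

end ChartMeasure
-- BODY END

end Summit.QuantumFields.YangMills.Theorems.FreeEnergyLogCoefficient

end
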